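import Literature.Probability.RandomPlanarGeometry.HexSAWBrickWallStrip
import HarnessLib

/-!
# Column cuts of a self-avoiding walk in a honeycomb strip: at least `⌊n/(T+1)⌋` cuts, and at least
# `⌊n/(2(T+1))⌋` parity-admissible ones

Topic `Literature/Probability/RandomPlanarGeometry` (continues `HexSAWBrickWallStrip.lean` — the row strips
`S_T = ℤ × {0,…,T}` of the brick wall = honeycomb lattice and their walks `HexBW.stripPairs T n` (pairs `(a, ω)`:
start `a` in the cross-section, translate `ω ∈ Zd.saws 2 n`, placed walk `t ↦ a + ω t` on brick-wall bonds inside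
`S_T`) — after the planar file `SAWStripInsertionMargin.lean` (lane item X16), whose private lemma `div_le_card_cuts`
("every `n`-step walk of `ℤ × {0,…,L}` crosses at least `n/(L+1)` column cuts") is re-proved here for the brick wall).
Source: N. Madras, G. Slade, *The Self-Avoiding Walk* (1993), §8.2, Theorem 8.2.1 (8.2.13) (strict monotonicity of
`μ(R[k,T])` in `T`; the lane proves it with explicit margins by COLUMN INSERTION at the cuts of the walk, and the
margin is `(density of usable cuts) × log(1 + μ^{-cost})`).  For the honeycomb strips the insertion (door
«HEX-STRIP-STRICT» of a-idea-1 gen 16, ROUTES-G16 §2) uses four new columns at the cuts `x = c + ½` with `c + T` ODD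
("parity-admissible"), so the density input is the number of admissible cuts — this file (face H4 of that door);
the analytic extraction is `HexSAWBrickWallStripMargin.lean` (face H5); the insertion itself (H1–H3) is not here.

## Contents (namespace `Literature.Probability.RandomPlanarGeometry.SAW.HexBW`, all PROVED)

* `cuts a ω n` — the columns `c` such that some step `t < n` of the placed walk `a + ω ·` crosses the line `x = c + ½`
  (then it is a horizontal brick-wall step between the abscissae `c` and `c + 1`); `admissibleCuts T a ω n` — those
  with `c + T` odd; `cols a ω n` — the visited abscissae;
* (private: `exists_cross_up`, `exists_cross_down`, discrete intermediate values — the tree's X16 helpers), `mem_cuts_of_le_of_lt`,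
  `Ico_subset_cuts` (every column between the leftmost and the rightmost visited one, the latter excluded, is a cut);
* `succ_le_card_cols_mul` — pigeonhole `n + 1 ≤ #cols · (T+1)`;
* **`div_le_card_cuts`** — `n / (T+1) ≤ #cuts`; `card_filter_odd_Ico_ge` (parity count in an integer interval);
  **`div_le_card_admissibleCuts`** — `n / (2(T+1)) ≤ #admissibleCuts`.
-/

noncomputable section

open Finset Literature.Probability.LatticeModels Literature.Probability.Percolation SimpleGraph

namespace Literature.Probability.RandomPlanarGeometry.SAW.HexBW

/-! ### Discrete intermediate values -/

/-- Discrete intermediate value property (upwards) for an integer sequence with increments `≤ 1`.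
[cite: MadrasSlade1993, §8.2, Theorem 8.2.1 (8.2.13) (column cuts of a strip walk)] -/
private theorem exists_cross_up {f : ℕ → ℤ} {v : ℤ} :
    ∀ b a : ℕ, (∀ t < b, f (t + 1) ≤ f t + 1) → a < b → f a ≤ v → v < f b →
      ∃ t < b, f t = v ∧ f (t + 1) = v + 1
  | 0, a, _, hab, _, _ => absurd hab (Nat.not_lt_zero a)
  | b + 1, a, hf, hab, ha, hb => by
    by_cases h : f b ≤ v
    · have := hf b (Nat.lt_succ_self b)
      exact ⟨b, Nat.lt_succ_self b, by omega, by omega⟩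
    · have hab' : a < b := by
        rcases Nat.lt_succ_iff_lt_or_eq.1 hab with h' | rfl
        · exact h'
        · exact absurd ha h
      obtain ⟨t, ht, h1, h2⟩ :=
        exists_cross_up b a (fun t ht => hf t (by omega)) hab' ha (by omega)
      exact ⟨t, by omega, h1, h2⟩

/-- Discrete intermediate value property (downwards) for an integer sequence with decrements `≤ 1`.
[cite: MadrasSlade1993, §8.2, Theorem 8.2.1 (8.2.13) (column cuts of a strip walk)] -/
private theorem exists_cross_down {f : ℕ → ℤ} {v : ℤ} :
    ∀ b a : ℕ, (∀ t < b, f t ≤ f (t + 1) + 1) → a < b → v < f a → f b ≤ v →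
      ∃ t < b, f t = v + 1 ∧ f (t + 1) = v
  | 0, a, _, hab, _, _ => absurd hab (Nat.not_lt_zero a)
  | b + 1, a, hf, hab, ha, hb => by
    by_cases h : v < f b
    · have := hf b (Nat.lt_succ_self b)
      exact ⟨b, Nat.lt_succ_self b, by omega, by omega⟩
    · have hab' : a < b := by
        rcases Nat.lt_succ_iff_lt_or_eq.1 hab with h' | rfl
        · exact h'
        · exact absurd ha h
      obtain ⟨t, ht, h1, h2⟩ :=
        exists_cross_down b a (fun t ht => hf t (by omega)) hab' ha (by omega)
      exact ⟨t, by omega, h1, h2⟩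

/-! ### Cuts, admissible cuts, visited columns -/

/-- The column cuts of the placed walk `t ↦ a + ω t` up to time `n`: the `c ∈ ℤ` such that some step crosses the line
`x = c + ½` (a horizontal brick-wall step between the abscissae `c` and `c + 1`, in either direction).
[cite: MadrasSlade1993, §8.2, Theorem 8.2.1 (8.2.13) (column cuts)] -/
def cuts (a : Site 2) (ω : ℕ → Site 2) (n : ℕ) : Finset ℤ :=
  ((Finset.range n).filter fun t => (a + ω t) 0 ≠ (a + ω (t + 1)) 0).image
    fun t => min ((a + ω t) 0) ((a + ω (t + 1)) 0)

/-- The PARITY-ADMISSIBLE cuts of the strip `S_T`: the cuts `c` with `c + T` odd (the places where the 4-column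
insertion of the door «HEX-STRIP-STRICT» can be performed). [cite: MadrasSlade1993, §8.2, Theorem 8.2.1 (8.2.13)] -/
def admissibleCuts (T : ℕ) (a : Site 2) (ω : ℕ → Site 2) (n : ℕ) : Finset ℤ :=
  (cuts a ω n).filter fun c : ℤ => (c + (T : ℤ)) % 2 = 1

/-- The visited abscissae of the placed walk up to time `n`. [cite: MadrasSlade1993, §8.2] -/
def cols (a : Site 2) (ω : ℕ → Site 2) (n : ℕ) : Finset ℤ := (Finset.range (n + 1)).image fun t => (a + ω t) 0

/-- Membership in `cuts`. [cite: MadrasSlade1993, §8.2, Theorem 8.2.1 (8.2.13)] -/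
theorem mem_cuts {a : Site 2} {ω : ℕ → Site 2} {n : ℕ} {c : ℤ} :
    c ∈ cuts a ω n ↔ ∃ t < n, (a + ω t) 0 ≠ (a + ω (t + 1)) 0 ∧ min ((a + ω t) 0) ((a + ω (t + 1)) 0) = c := by
  simp only [cuts, mem_image, mem_filter, mem_range]
  constructor
  · rintro ⟨t, ⟨ht, hne⟩, hc⟩; exact ⟨t, ht, hne, hc⟩
  · rintro ⟨t, ht, hne, hc⟩; exact ⟨t, ⟨ht, hne⟩, hc⟩

/-- Membership in `admissibleCuts`. [cite: MadrasSlade1993, §8.2, Theorem 8.2.1 (8.2.13)] -/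
theorem mem_admissibleCuts {T : ℕ} {a : Site 2} {ω : ℕ → Site 2} {n : ℕ} {c : ℤ} :
    c ∈ admissibleCuts T a ω n ↔ c ∈ cuts a ω n ∧ (c + (T : ℤ)) % 2 = 1 := mem_filter

/-- `#admissibleCuts ≤ #cuts ≤ n`. [cite: MadrasSlade1993, §8.2] -/
theorem card_cuts_le (a : Site 2) (ω : ℕ → Site 2) (n : ℕ) : (cuts a ω n).card ≤ n :=
  (card_image_le.trans (card_filter_le _ _)).trans (by rw [card_range])

section StripWalk

variable {T n : ℕ} {a : Site 2} {ω : ℕ → Site 2}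

/-- Consecutive abscissae of a brick-wall walk differ by at most one. [cite: EntingJensen2009, §7.4.2, Fig. 7.10 (brickwork form of the honeycomb lattice)] -/
theorem col_step (hp : (a, ω) ∈ stripPairs T n) {t : ℕ} (ht : t < n) :
    (a + ω (t + 1)) 0 ≤ (a + ω t) 0 + 1 ∧ (a + ω t) 0 ≤ (a + ω (t + 1)) 0 + 1 := by
  obtain ⟨-, -, hbw, -⟩ := mem_stripPairs.1 hp
  dsimp only at hbw
  have h := abs_sub_apply_zero_le_one (hbw t ht)
  rw [abs_le] at h
  constructor <;> linarith [h.1, h.2]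

/-- **Every column weakly right of one visited abscissa and strictly left of another is a cut** (discrete
intermediate values along the walk, in the direction of time that applies). [cite: MadrasSlade1993, §8.2, Theorem 8.2.1 (8.2.13)] -/
theorem mem_cuts_of_le_of_lt (hp : (a, ω) ∈ stripPairs T n) {s s' : ℕ} (hs : s ≤ n) (hs' : s' ≤ n) {c : ℤ}
    (h1 : (a + ω s) 0 ≤ c) (h2 : c < (a + ω s') 0) : c ∈ cuts a ω n := by
  have hne : s ≠ s' := by rintro rfl; omega
  rcases lt_or_gt_of_ne hne with hlt | hgt
  · obtain ⟨t, ht, e1, e2⟩ := exists_cross_up (f := fun t => (a + ω t) 0) s' s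
      (fun t ht => (col_step hp (by omega)).1) hlt h1 h2
    exact mem_cuts.2 ⟨t, by omega, by omega, by rw [e1, e2]; simp⟩
  · obtain ⟨t, ht, e1, e2⟩ := exists_cross_down (f := fun t => (a + ω t) 0) s s'
      (fun t ht => (col_step hp (by omega)).2) hgt h2 h1
    exact mem_cuts.2 ⟨t, by omega, by omega, by rw [e1, e2]; simp⟩

/-- The columns visited form a nonempty set. [cite: MadrasSlade1993, §8.2] -/
theorem cols_nonempty (a : Site 2) (ω : ℕ → Site 2) (n : ℕ) : (cols a ω n).Nonempty :=
  ⟨(a + ω 0) 0, mem_image.2 ⟨0, by simp, rfl⟩⟩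

/-- **Every column from the leftmost visited one (included) to the rightmost (excluded) is a cut.**
[cite: MadrasSlade1993, §8.2, Theorem 8.2.1 (8.2.13)] -/
theorem Ico_subset_cuts (hp : (a, ω) ∈ stripPairs T n) :
    Finset.Ico ((cols a ω n).min' (cols_nonempty a ω n)) ((cols a ω n).max' (cols_nonempty a ω n)) ⊆ cuts a ω n := by
  intro c hc
  rw [Finset.mem_Ico] at hc
  obtain ⟨s, hs, hse⟩ := mem_image.1 (Finset.min'_mem _ (cols_nonempty a ω n))
  obtain ⟨s', hs', hs'e⟩ := mem_image.1 (Finset.max'_mem _ (cols_nonempty a ω n))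
  have hsn : s ≤ n := by simpa [Nat.lt_succ_iff] using hs
  have hs'n : s' ≤ n := by simpa [Nat.lt_succ_iff] using hs'
  exact mem_cuts_of_le_of_lt hp hsn hs'n (by rw [hse]; exact hc.1) (by rw [hs'e]; exact hc.2)

/-- The visited columns lie between the leftmost and the rightmost one: `#cols ≤ max − min + 1`.
[cite: MadrasSlade1993, §8.2] -/
theorem card_cols_le (a : Site 2) (ω : ℕ → Site 2) (n : ℕ) :
    ((cols a ω n).card : ℤ) ≤
      (cols a ω n).max' (cols_nonempty a ω n) - (cols a ω n).min' (cols_nonempty a ω n) + 1 := by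
  have hsub : cols a ω n ⊆ Finset.Icc ((cols a ω n).min' (cols_nonempty a ω n))
      ((cols a ω n).max' (cols_nonempty a ω n)) := fun c hc =>
    Finset.mem_Icc.2 ⟨Finset.min'_le _ _ hc, Finset.le_max' _ _ hc⟩
  have h := Finset.card_le_card hsub
  rw [Int.card_Icc] at h
  have : (((cols a ω n).max' (cols_nonempty a ω n) + 1 - (cols a ω n).min' (cols_nonempty a ω n)).toNat : ℤ) =
      (cols a ω n).max' (cols_nonempty a ω n) + 1 - (cols a ω n).min' (cols_nonempty a ω n) :=
    Int.toNat_of_nonneg (by linarith [Finset.min'_le (cols a ω n) _ (Finset.max'_mem _ (cols_nonempty a ω n))])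
  have h' : ((cols a ω n).card : ℤ) ≤ (((cols a ω n).max' (cols_nonempty a ω n) + 1 -
      (cols a ω n).min' (cols_nonempty a ω n)).toNat : ℤ) := by exact_mod_cast h
  linarith

/-- **Pigeonhole**: the `n + 1` distinct sites of the walk lie in `#cols` columns of `T + 1` sites each:
`n + 1 ≤ #cols · (T+1)`. [cite: MadrasSlade1993, §8.2, Theorem 8.2.1 (8.2.13)] -/
theorem succ_le_card_cols_mul (hp : (a, ω) ∈ stripPairs T n) : n + 1 ≤ (cols a ω n).card * (T + 1) := by
  obtain ⟨-, hω, -, hR⟩ := mem_stripPairs.1 hp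
  dsimp only at hω hR
  obtain ⟨-, -, -, hinj⟩ := Zd.mem_saws.1 hω
  have h := Finset.card_le_card_of_injOn (s := Finset.range (n + 1)) (t := cols a ω n ×ˢ Finset.range (T + 1))
    (fun t => ((a + ω t) 0, ((a + ω t) 1).toNat)) (fun t ht => ?_) (fun t ht t' ht' h => ?_)
  · simpa using h
  · have ht' : t ≤ n := by simpa [Nat.lt_succ_iff] using ht
    simp only [Finset.coe_product, Finset.coe_range, Set.mem_prod, Finset.mem_coe, Set.mem_Iio]
    refine ⟨mem_image.2 ⟨t, by simpa using ht, rfl⟩, ?_⟩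
    have h1 := (hR t ht').1; have h2 := (hR t ht').2; omega
  · have htn : t ≤ n := by simpa [Nat.lt_succ_iff] using ht
    have htn' : t' ≤ n := by simpa [Nat.lt_succ_iff] using ht'
    simp only [Prod.mk.injEq] at h
    have h0 := (hR t htn).1; have h0' := (hR t' htn').1
    have e1 : (a + ω t) 1 = (a + ω t') 1 := by omega
    have e : ω t = ω t' := by
      have ha : a + ω t = a + ω t' := by
        funext i; fin_cases i
        · exact h.1
        · exact e1
      exact add_left_cancel ha
    exact hinj htn htn' e

/-- **Every `n`-step walk of the strip `S_T` has at least `n / (T+1)` column cuts.**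
[cite: MadrasSlade1993, §8.2, Theorem 8.2.1 (8.2.13)] -/
theorem div_le_card_cuts (hp : (a, ω) ∈ stripPairs T n) : n / (T + 1) ≤ (cuts a ω n).card := by
  have h1 := Finset.card_le_card (Ico_subset_cuts hp)
  rw [Int.card_Ico] at h1
  have h2 := card_cols_le a ω n
  have h3 := succ_le_card_cols_mul hp
  have h4 : n / (T + 1) < (cols a ω n).card := by
    by_contra h
    have : (cols a ω n).card * (T + 1) ≤ n / (T + 1) * (T + 1) := Nat.mul_le_mul_right _ (not_lt.1 h)
    have h5 : n / (T + 1) * (T + 1) ≤ n := Nat.div_mul_le_self n (T + 1)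
    omega
  have h6 : ((cols a ω n).card : ℤ) - 1 ≤
      (((cols a ω n).max' (cols_nonempty a ω n) - (cols a ω n).min' (cols_nonempty a ω n)).toNat : ℤ) := by
    have := Int.self_le_toNat ((cols a ω n).max' (cols_nonempty a ω n) - (cols a ω n).min' (cols_nonempty a ω n))
    linarith
  have h7 : (cols a ω n).card - 1 ≤ (cuts a ω n).card := by
    have : ((cols a ω n).card : ℤ) - 1 ≤ ((cuts a ω n).card : ℤ) := h6.trans (by exact_mod_cast h1)
    omega
  omega

/-! ### Parity-admissible cuts -/

/-- **Parity count in an integer interval**: among the integers `c` with `m ≤ c < M`, at least `⌊(M − m)/2⌋` have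
`c + T` odd (the arithmetic progression `m + r, m + r + 2, …` with the right `r ∈ {0, 1}`).
[cite: MadrasSlade1993, §8.2, Theorem 8.2.1 (8.2.13)] -/
theorem card_filter_odd_Ico_ge (T : ℕ) (m M : ℤ) :
    (M - m).toNat / 2 ≤ ((Finset.Ico m M).filter fun c : ℤ => (c + (T : ℤ)) % 2 = 1).card := by
  classical
  set r : ℤ := if (m + (T : ℤ)) % 2 = 1 then 0 else 1 with hr
  have hr01 : 0 ≤ r ∧ r ≤ 1 := by rw [hr]; split_ifs <;> omega
  have hpar : (m + r + (T : ℤ)) % 2 = 1 := by rw [hr]; split_ifs with h <;> omega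
  have h := Finset.card_le_card_of_injOn (s := Finset.range ((M - m).toNat / 2))
    (t := (Finset.Ico m M).filter fun c : ℤ => (c + (T : ℤ)) % 2 = 1) (fun k => m + r + 2 * (k : ℤ)) (fun k hk => ?_)
    (fun k _ k' _ hkk => by exact_mod_cast (show (k : ℤ) = k' by simp only at hkk; omega))
  · simpa using h
  · have hk' : k < (M - m).toNat / 2 := by simpa using hk
    have hpos : 0 ≤ M - m := by
      by_contra hneg
      rw [Int.toNat_of_nonpos (by omega)] at hk'
      omega
    have hMm : ((M - m).toNat : ℤ) = M - m := Int.toNat_of_nonneg hpos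
    have hd : 2 * ((k : ℤ) + 1) ≤ ((M - m).toNat : ℤ) := by
      exact_mod_cast (show 2 * (k + 1) ≤ (M - m).toNat by omega)
    show m + r + 2 * (k : ℤ) ∈ (((Finset.Ico m M).filter fun c : ℤ => (c + (T : ℤ)) % 2 = 1) : Set ℤ)
    rw [Finset.mem_coe, Finset.mem_filter, Finset.mem_Ico]
    exact ⟨⟨by omega, by omega⟩, by omega⟩

/-- **Every `n`-step walk of `S_T` has at least `n / (2(T+1))` parity-admissible cuts.**
[cite: MadrasSlade1993, §8.2, Theorem 8.2.1 (8.2.13)] -/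
theorem div_le_card_admissibleCuts (hp : (a, ω) ∈ stripPairs T n) :
    n / (2 * (T + 1)) ≤ (admissibleCuts T a ω n).card := by
  classical
  set m := (cols a ω n).min' (cols_nonempty a ω n) with hm
  set M := (cols a ω n).max' (cols_nonempty a ω n) with hM
  -- admissible cuts ⊇ the odd-parity columns of `[m, M)`
  have hsub : ((Finset.Ico m M).filter fun c : ℤ => (c + (T : ℤ)) % 2 = 1) ⊆ admissibleCuts T a ω n := by
    intro c hc
    rw [mem_filter] at hc
    exact mem_admissibleCuts.2 ⟨Ico_subset_cuts hp hc.1, hc.2⟩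
  have h1 := (card_filter_odd_Ico_ge T m M).trans (Finset.card_le_card hsub)
  -- `#cols - 1 ≤ M - m` and `n/(T+1) < #cols`
  have h2 := card_cols_le a ω n
  have h3 := succ_le_card_cols_mul hp
  have h4 : n / (T + 1) < (cols a ω n).card := by
    by_contra h
    have : (cols a ω n).card * (T + 1) ≤ n / (T + 1) * (T + 1) := Nat.mul_le_mul_right _ (not_lt.1 h)
    have h5 : n / (T + 1) * (T + 1) ≤ n := Nat.div_mul_le_self n (T + 1)
    omega
  have h6 : (cols a ω n).card - 1 ≤ (M - m).toNat := by
    have := Int.self_le_toNat (M - m)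
    have h2' : ((cols a ω n).card : ℤ) ≤ M - m + 1 := h2
    omega
  have h7 : n / (2 * (T + 1)) = n / (T + 1) / 2 := by rw [Nat.div_div_eq_div_mul, mul_comm]
  rw [h7]
  calc n / (T + 1) / 2 ≤ ((cols a ω n).card - 1) / 2 := Nat.div_le_div_right (by omega)
    _ ≤ (M - m).toNat / 2 := Nat.div_le_div_right h6
    _ ≤ _ := h1

end StripWalk

end Literature.Probability.RandomPlanarGeometry.SAW.HexBW
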